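import Summits.QuantumFields.YangMills.Theses.CovariantDischarge
import Summits.QuantumFields.YangMills.Theorems.UnitScaleTiltHistoryTailLOfFirstExitTail

/-!
# Route `CovariantDischarge` — the glue `HistoryTailOfSplit` (stmt-QuantumFields-22895), PROVED
# (ideator seat `ym-r3-idea-2` gen 6, LINE 12 on crux stmt-QuantumFields-19936 `UnitScaleTilt.HistoryTailL`)

The route splits route `FirstExitWindow`'s crux `FirstExitWindowTailL` (stmt-QuantumFields-26243, the first-exit WINDOW tail of the
block-averaged plaquette) by DEPTH of the averaged level `j` inside the cut-off `K`: `LevelOneWindowTailL` (`j = 1`),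
`FractionalWindowTailL` (`2 ≤ j`, `N₁·j ≤ K` for some `N₁`), `DeepWindowTailL` (`K < N₁·j`, every `N₁`).  This file proves the
logic item of the route: the three ranges recombine to `FirstExitWindowTailL` (constants merged by monotonicity of the schema
bound), hence to the parent crux `UnitScaleTilt.HistoryTailL` by the landed `unitScaleTilt_historyTailL_of_firstExitWindowTailL`
(the `Assembly` item stmt-QuantumFields-22896 is already landed by the gate in `Theorems/CovariantDischargeAssembly.lean`).

WHAT THIS IS NOT: the three range cruxes are OPEN — this is pure bookkeeping; no tail estimate is proved, rung R3 (`YM3TorusSU2`) is a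
RECORD rung, not the Clay statement, and nothing here bears on the Yang–Mills mass gap.

References: T. Bałaban, CMP 102 (1985) 255–275 [Balaban1985UV3] ((7) p.257: `β_k = L^k/γ`, the profile `p(g)`); C. King, CMP 103
(1986) 323–349 [King1986].
-/

namespace Summit.QuantumFields.YangMills.Theorems

open Literature.MathematicalPhysics.QuantumFieldTheory.Balaban1983to89
open Literature.MathematicalPhysics.QuantumFieldTheory.Balaban1983to89.T3ContinuumYM3Torus

/-- Monotonicity of the schema bound in its constants (`1 ≤ β`, `0 ≤ t`). [folklore] -/
private theorem cd_schema_mono {x Cx C β cx c t : ℝ} {Nx N : ℕ} (hβ : 1 ≤ β) (hN : Nx ≤ N) (hc : c ≤ cx)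
    (ht : 0 ≤ t) (hCx : |Cx| ≤ C) (h : x ≤ Cx * β ^ Nx * Real.exp (-(cx * t))) :
    x ≤ C * β ^ N * Real.exp (-(c * t)) := by
  have hβ0 : 0 ≤ β := zero_le_one.trans hβ
  have h1 : Cx * β ^ Nx * Real.exp (-(cx * t)) ≤ |Cx| * β ^ Nx * Real.exp (-(cx * t)) :=
    mul_le_mul_of_nonneg_right (mul_le_mul_of_nonneg_right (le_abs_self Cx) (pow_nonneg hβ0 Nx))
      (Real.exp_nonneg _)
  have h2 : |Cx| * β ^ Nx * Real.exp (-(cx * t)) ≤ C * β ^ N * Real.exp (-(c * t)) := by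
    have hC0 : 0 ≤ C := (abs_nonneg Cx).trans hCx
    have hpow : β ^ Nx ≤ β ^ N := pow_le_pow_right₀ hβ hN
    have hexp : Real.exp (-(cx * t)) ≤ Real.exp (-(c * t)) :=
      Real.exp_le_exp.mpr (neg_le_neg (mul_le_mul_of_nonneg_right hc ht))
    calc |Cx| * β ^ Nx * Real.exp (-(cx * t)) ≤ C * β ^ N * Real.exp (-(cx * t)) :=
          mul_le_mul_of_nonneg_right (mul_le_mul hCx hpow (pow_nonneg hβ0 Nx) hC0) (Real.exp_nonneg _)
      _ ≤ C * β ^ N * Real.exp (-(c * t)) :=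
          mul_le_mul_of_nonneg_left hexp (mul_nonneg hC0 (pow_nonneg hβ0 N))
  exact h.trans (h1.trans h2)

/-- `1 ≤ β_(K−j) = (γ L^{-(K−j)})⁻¹` on a Bałaban family when `γ ≤ 1`. [folklore] -/
private theorem cd_one_le_beta (F : T3Family) {γ : ℝ} (hγ : 0 < γ) (hγ1 : γ ≤ 1) (K j : ℕ) :
    (1 : ℝ) ≤ (γ * ((F.L : ℝ)⁻¹) ^ (K - j))⁻¹ := by
  have hL1 : (1 : ℝ) ≤ F.L := by exact_mod_cast F.hL.2.le
  have hL0 : (0 : ℝ) < F.L := one_pos.trans_le hL1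
  have hq0 : 0 < γ * ((F.L : ℝ)⁻¹) ^ (K - j) := mul_pos hγ (pow_pos (inv_pos.mpr hL0) _)
  have hq1 : γ * ((F.L : ℝ)⁻¹) ^ (K - j) ≤ 1 := by
    have h1 : ((F.L : ℝ)⁻¹) ^ (K - j) ≤ 1 := pow_le_one₀ (inv_nonneg.mpr hL0.le) (inv_le_one_of_one_le₀ hL1)
    calc γ * ((F.L : ℝ)⁻¹) ^ (K - j) ≤ 1 * 1 := mul_le_mul hγ1 h1 (pow_nonneg (inv_nonneg.mpr hL0.le) _) zero_le_one
      _ = 1 := one_mul 1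
  exact (one_le_inv₀ hq0).mpr hq1

/-- The three ranges recombine to route FirstExitWindow's crux `FirstExitWindowTailL` (stmt-26243): pure logic — take `N₁` from the fractional range, instantiate the deep range at `N₁`, merge the constants
(`γ₁ = min`, `C = Σ|Cᵢ|`, `c = min`, `N = Σ Nᵢ`; `β_(K−j) ≥ 1`). [folklore] -/
theorem covariantDischarge_firstExitWindowTailL_of_ranges (h1 : Summit.QuantumFields.YangMills.Theses.CovariantDischarge.LevelOneWindowTailL)
    (hF : Summit.QuantumFields.YangMills.Theses.CovariantDischarge.FractionalWindowTailL)
    (hD : Summit.QuantumFields.YangMills.Theses.CovariantDischarge.DeepWindowTailL) :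
    Summit.QuantumFields.YangMills.Theses.FirstExitWindow.FirstExitWindowTailL := by
  intro L b₀ p₀ b₂ hb₀ hp₀ hb₂
  obtain ⟨N₁, hN₁, hF'⟩ := hF L
  obtain ⟨γa, Ca, ca, Na, hγa, hγa1, hca, hA⟩ := h1 L b₀ p₀ b₂ hb₀ hp₀ hb₂
  obtain ⟨γb, Cb, cb, Nb, hγb, hγb1, hcb, hB⟩ := hF' b₀ p₀ b₂ hb₀ hp₀ hb₂
  obtain ⟨γc, Cc, cc, Nc, hγc, hγc1, hcc, hC⟩ := hD L N₁ hN₁ b₀ p₀ b₂ hb₀ hp₀ hb₂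
  refine ⟨min γa (min γb γc), |Ca| + |Cb| + |Cc|, min ca (min cb cc), Na + Nb + Nc,
    lt_min hγa (lt_min hγb hγc), (min_le_left _ _).trans hγa1, lt_min hca (lt_min hcb hcc), ?_⟩
  intro F γ hFL hγ hγ1 K j hj1 hjK p
  have hγa' : γ ≤ γa := hγ1.trans (min_le_left _ _)
  have hγb' : γ ≤ γb := hγ1.trans ((min_le_right _ _).trans (min_le_left _ _))
  have hγc' : γ ≤ γc := hγ1.trans ((min_le_right _ _).trans (min_le_right _ _))
  have hβ := cd_one_le_beta F hγ (hγa'.trans hγa1) K j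
  have ht : (0 : ℝ) ≤ B10.pFun b₀ p₀ (Real.sqrt (γ * ((F.L : ℝ)⁻¹) ^ (K - j))) ^ 2 := sq_nonneg _
  have hCa : |Ca| ≤ |Ca| + |Cb| + |Cc| := by linarith [abs_nonneg Cb, abs_nonneg Cc]
  have hCb : |Cb| ≤ |Ca| + |Cb| + |Cc| := by linarith [abs_nonneg Ca, abs_nonneg Cc]
  have hCc : |Cc| ≤ |Ca| + |Cb| + |Cc| := by linarith [abs_nonneg Ca, abs_nonneg Cb]
  by_cases hj : j = 1
  · exact cd_schema_mono hβ (by omega) (min_le_left _ _) ht hCa (hA F γ hFL hγ hγa' K j hj (by omega) p)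
  · by_cases hr : N₁ * j ≤ K
    · exact cd_schema_mono hβ (by omega) ((min_le_right _ _).trans (min_le_left _ _)) ht hCb
        (hB F γ hFL hγ hγb' K j (by omega) hr p)
    · exact cd_schema_mono hβ (by omega) ((min_le_right _ _).trans (min_le_right _ _)) ht hCc
        (hC F γ hFL hγ hγc' K j hj1 hjK (by omega) p)


/-- **The glue item `HistoryTailOfSplit` (stmt-QuantumFields-22895), PROVED**: the three depth ranges give the parent crux
`UnitScaleTilt.HistoryTailL` (via `FirstExitWindowTailL` and the landed `unitScaleTilt_historyTailL_of_firstExitWindowTailL`).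
Conditional bookkeeping only. [cite: Balaban1985UV3, (7) p.257] -/
theorem covariantDischarge_historyTailOfSplit_proof : Summit.QuantumFields.YangMills.Theses.CovariantDischarge.HistoryTailOfSplit := fun h1 hF hD =>
  unitScaleTilt_historyTailL_of_firstExitWindowTailL (covariantDischarge_firstExitWindowTailL_of_ranges h1 hF hD)

end Summit.QuantumFields.YangMills.Theorems
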